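import Summits.RiemannHypothesis.RiemannHypothesis.Theorems.EtaLeadingQuarterSecondMomentZerosDual
import Summits.RiemannHypothesis.RiemannHypothesis.Theorems.EtaLeadingQuarterSecondMomentZerosHighBands
import Summits.RiemannHypothesis.RiemannHypothesis.Theorems.EtaLeadingQuarterEtaLeadingSecondMomentSmallHeight
import HarnessLib

/-!
# The second moment of the sharp eta vector at the zeros, zero side VIII: assembly core
(route EtaLeadingQuarter, item `EtaLeadingSecondMoment`, stmt-RiemannHypothesis-21791)

`γ_n = zetaOrdinate n`, `N(T) = zetaZeroCount T`, `V_M(γ) = −1 + ∑_{m=2}^{M} (−1)^m m^{-1/2} m^{iγ}` (the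
vector of the statement), `T_M(s) = ∑_{m ≤ M} (−1)^m m^{-s}`, `S(y,t) = ∑_{k odd ≤ y} k^{-1/2} k^{-it}`.
This file reduces `EtaLeadingSecondMoment` to a PER-ZERO ENGINE HYPOTHESIS

  `hEng : ∀ n, 4⌊M/2⌋ < γ_n ≤ T₂ → ‖T_M(1/2 + iγ_n)‖ ≤ √2 ‖S(⌊γ_n/(πM)⌋, γ_n)‖ + E_n`

(the AFE at the zero `1/2 + iγ_n`, sibling files `…SecondMomentAFE*`, `…SecondMomentMainTerm`):
`assembly_core` — under RH, for `M ≥ 801`, `0 < θ ≤ 1`, `T₂ ≥ max(4⌊M/2⌋, 2516)` and any `E`,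
`M ∑_ρ m γ^{-2} ‖V_M(γ)‖² ≤ 576 B₀ + (1+θ)(log M/4 + C₁ + C₂ (1+log T₂)⁴/M) + 2(1+1/θ) M ∑ E_n²/γ_n²`
`  + 432 A M (1+log T₂)(T₂+M) T₂^{-2} (3/2 + (log M)²/2)(1 + log(M+1))`
(low zeros: `EtaTrial.smallHeight_le`; main term: `Zeros.dual_main_le`; high bands:
`Zeros.highBands_le`; dictionary `Zeros.sum_zerosBetween_eq_sum_Ico`). Also the conversions
`trialVector_eq_dirPoly_neg` (`V_M(γ) = D_a(−γ)`), `altSum_half_eq_dirPoly` (`T_M(1/2+it) = D_a(t)`),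
`a_k = (−1)^k k^{-1/2}`. Nothing here bears on the truth of RH.
-/

noncomputable section

open Real Finset Filter Topology Complex

set_option linter.dupNamespace false  -- the mandated namespace repeats `RiemannHypothesis`

namespace Summit.RiemannHypothesis.RiemannHypothesis.Theorems.EtaLeadingQuarter.Zeros

open Literature.NumberTheory.LFunctions NicolasJExplicit SchoenfeldBound ZeroSide

/-! ## The eta coefficients `a_k = (−1)^k k^{-1/2}` -/

/-- `(m : ℂ)^{-1/2 as a real exponent} = ((m : ℝ)^{-1/2} : ℝ)`. [folklore] -/
theorem natCast_cpow_neg_half (m : ℕ) :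
    (m : ℂ) ^ (((-(1 / 2 : ℝ)) : ℝ) : ℂ) = (((m : ℝ) ^ (-(1 / 2 : ℝ)) : ℝ) : ℂ) := by
  rw [Complex.ofReal_cpow (Nat.cast_nonneg m)]; push_cast; rfl

/-- **The statement's vector is `D_a(−γ)`**: for `M ≥ 1`,
`−1 + ∑_{m=2}^{M} (−1)^m m^{-1/2} m^{iγ} = ∑_{k=1}^{M} a_k k^{-i(−γ)}`. [folklore] -/
theorem trialVector_eq_dirPoly_neg {M : ℕ} (hM : 1 ≤ M) (γ : ℝ) :
    -1 + ∑ m ∈ Finset.Icc 2 M, ((((-1 : ℝ) ^ m * (m : ℝ) ^ (-(1 / 2 : ℝ))) : ℝ) : ℂ) *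
        (m : ℂ) ^ (((γ : ℝ) : ℂ) * I) =
      dirPoly (fun k ↦ (-1 : ℝ) ^ k * (k : ℝ) ^ (-(1 / 2 : ℝ))) M (-γ) := by
  unfold dirPoly
  rw [← Finset.insert_Icc_add_one_left_eq_Icc hM, Finset.sum_insert (by simp)]
  have e : ∀ m ∈ Finset.Icc 2 M, ((((-1 : ℝ) ^ m * (m : ℝ) ^ (-(1 / 2 : ℝ))) : ℝ) : ℂ) *
      (m : ℂ) ^ (((γ : ℝ) : ℂ) * I) =
      ((((-1 : ℝ) ^ m * (m : ℝ) ^ (-(1 / 2 : ℝ))) : ℝ) : ℂ) * (m : ℂ) ^ (-((((-γ : ℝ)) : ℂ) * I)) := by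
    intro m _
    congr 1
    push_cast
    ring_nf
  rw [Finset.sum_congr rfl e]
  simp

/-- Hence `‖V_M(γ)‖ = ‖D_a(γ)‖`. [folklore] -/
theorem norm_trialVector_eq {M : ℕ} (hM : 1 ≤ M) (γ : ℝ) :
    ‖-1 + ∑ m ∈ Finset.Icc 2 M, ((((-1 : ℝ) ^ m * (m : ℝ) ^ (-(1 / 2 : ℝ))) : ℝ) : ℂ) *
        (m : ℂ) ^ (((γ : ℝ) : ℂ) * I)‖ =
      ‖dirPoly (fun k ↦ (-1 : ℝ) ^ k * (k : ℝ) ^ (-(1 / 2 : ℝ))) M γ‖ := by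
  rw [trialVector_eq_dirPoly_neg hM, norm_dirPoly_neg]

/-- **`T_M(1/2 + it) = D_a(t)`**: `∑_{m≤M} (−1)^m m^{−(1/2+it)} = ∑_{k≤M} a_k k^{-it}`. [folklore] -/
theorem altSum_half_eq_dirPoly (M : ℕ) (t : ℝ) :
    ∑ m ∈ Finset.Icc 1 M, (-1 : ℂ) ^ m * (m : ℂ) ^ (-((1 / 2 : ℂ) + (t : ℂ) * I)) =
      dirPoly (fun k ↦ (-1 : ℝ) ^ k * (k : ℝ) ^ (-(1 / 2 : ℝ))) M t := by
  unfold dirPoly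
  refine Finset.sum_congr rfl fun m hm ↦ ?_
  rw [Finset.mem_Icc] at hm
  have hm0 : (m : ℂ) ≠ 0 := Nat.cast_ne_zero.2 (by omega)
  have e1 : -((1 / 2 : ℂ) + (t : ℂ) * I) = (((-(1 / 2 : ℝ)) : ℝ) : ℂ) + -((t : ℂ) * I) := by
    push_cast; ring
  rw [e1, Complex.cpow_add _ _ hm0, natCast_cpow_neg_half]
  push_cast
  ring

/-- `∑_{k≤M} a_k² = ∑_{k≤M} 1/k ≤ 1 + log(M+1)`. [folklore] -/
theorem sum_etaCoeff_sq_le (M : ℕ) :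
    ∑ k ∈ Finset.Icc 1 M, ((-1 : ℝ) ^ k * (k : ℝ) ^ (-(1 / 2 : ℝ))) ^ 2 ≤ 1 + Real.log (M + 1) := by
  refine le_trans (le_of_eq (Finset.sum_congr rfl fun k hk ↦ ?_)) (AFE.sum_Icc_inv_le_log M)
  rw [Finset.mem_Icc] at hk
  have hk0 : (0 : ℝ) < k := by exact_mod_cast hk.1
  have h1 : ((-1 : ℝ) ^ k) ^ 2 = 1 := by rw [← pow_mul, mul_comm k 2, pow_mul, neg_one_sq, one_pow]
  have h2 : ((k : ℝ) ^ (-(1 / 2 : ℝ))) ^ 2 = 1 / (k : ℝ) := by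
    rw [← Real.rpow_natCast, ← Real.rpow_mul hk0.le,
      show (-(1 / 2 : ℝ)) * ((2 : ℕ) : ℝ) = -1 by norm_num, Real.rpow_neg_one, one_div]
  rw [mul_pow, h1, h2, one_mul]

/-! ## The middle block over the enumeration -/

/-- **Middle block**: for `0 ≤ T₁ ≤ T₂`,
`∑_{T₁ < |γ| ≤ T₂} m γ^{-2} ‖D_a(γ)‖² = 2 ∑_{N(T₁) ≤ n < N(T₂)} ‖D_a(γ_n)‖²/γ_n²`. [folklore] -/
theorem sum_sdiff_eq_two_mul_sum_Ico (a : ℕ → ℝ) (M : ℕ) {T₁ T₂ : ℝ} (h0 : 0 ≤ T₁) (h12 : T₁ ≤ T₂) :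
    ∑ ρ ∈ zerosUpTo T₂ \ zerosUpTo T₁,
        (riemannZetaZeroOrder (ρ : ℂ) : ℝ) / (ρ : ℂ).im ^ 2 * ‖dirPoly a M (ρ : ℂ).im‖ ^ 2 =
      2 * ∑ n ∈ Finset.Ico (zetaZeroCount T₁) (zetaZeroCount T₂),
        ‖dirPoly a M (zetaOrdinate n)‖ ^ 2 / zetaOrdinate n ^ 2 := by
  have h2 := sum_sdiff_zerosUpTo_eq_two_mul (T₁ := T₁) (T₂ := T₂) h0
    (g := fun z ↦ (riemannZetaZeroOrder z : ℝ) / z.im ^ 2 * ‖dirPoly a M z.im‖ ^ 2) (fun z ↦ by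
      simp only [riemannZetaZeroOrder_conj_holds z, Complex.conj_im, neg_sq, norm_dirPoly_neg])
  rw [h2, ← sum_zerosBetween_eq_sum_Ico (fun t ↦ ‖dirPoly a M t‖ ^ 2 / t ^ 2) h0 h12]
  congr 1
  refine Finset.sum_congr rfl fun ρ _ ↦ ?_
  ring

/-- `(u + v)² ≤ (1 + θ) u² + (1 + 1/θ) v²` for `θ > 0`. [folklore] -/
theorem add_sq_le_split {θ : ℝ} (hθ : 0 < θ) (u v : ℝ) :
    (u + v) ^ 2 ≤ (1 + θ) * u ^ 2 + (1 + 1 / θ) * v ^ 2 := by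
  have h : 0 ≤ (θ * u - v) ^ 2 / θ := by positivity
  have e : (1 + θ) * u ^ 2 + (1 + 1 / θ) * v ^ 2 - (u + v) ^ 2 = (θ * u - v) ^ 2 / θ := by
    field_simp
    ring
  linarith

/-! ## Assembly core -/

/-- **Assembly core for `EtaLeadingSecondMoment`.** Under RH and the local density constant `A`
there are `C₁, C₂ ≥ 0` such that for `M ≥ 801`, `0 < θ ≤ 1`, `T₂ ≥ max(4⌊M/2⌋, 2516)` and every error
sequence `E` satisfying the per-zero ENGINE HYPOTHESIS
`∀ n, N(4⌊M/2⌋) ≤ n < N(T₂) → ‖T_M(1/2+iγ_n)‖ ≤ √2 ‖S(⌊γ_n/(πM)⌋, γ_n)‖ + E_n`: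
`M ∑_ρ m γ^{-2} ‖V_M(γ)‖² ≤ 576 B₀ + (1+θ)(log M/4 + C₁ + C₂(1+log T₂)⁴/M)`
`  + 2(1+1/θ) M ∑_{N(4⌊M/2⌋) ≤ n < N(T₂)} E_n²/γ_n² + 432 A M (1+log T₂)(T₂+M) T₂^{-2} (3/2+(log M)²/2)(1+log(M+1))`,
`B₀ = ∑_ρ m/γ²`. [folklore] -/
theorem assembly_core (hRH : RiemannHypothesis) {A : ℝ} (hA0 : 0 ≤ A)
    (hA : ∀ t : ℝ, 0 ≤ t → (zetaZeroCount (t + 1) : ℝ) - zetaZeroCount t ≤ A * Real.log (t + 2)) :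
    ∃ C₁ C₂ : ℝ, 0 ≤ C₁ ∧ 0 ≤ C₂ ∧ ∀ M : ℕ, 801 ≤ M → ∀ θ : ℝ, 0 < θ → θ ≤ 1 →
      ∀ T₂ : ℝ, 4 * ((M / 2 : ℕ) : ℝ) ≤ T₂ → 2516 ≤ T₂ → ∀ E : ℕ → ℝ,
      (∀ n ∈ Finset.Ico (zetaZeroCount (4 * ((M / 2 : ℕ) : ℝ))) (zetaZeroCount T₂),
        ‖∑ m ∈ Finset.Icc 1 M, (-1 : ℂ) ^ m * (m : ℂ) ^ (-((1 / 2 : ℂ) + (zetaOrdinate n : ℂ) * I))‖ ≤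
          Real.sqrt 2 * ‖∑ k ∈ (Finset.Icc 1 ⌊zetaOrdinate n / (π * M)⌋₊).filter Odd,
              (((1 / Real.sqrt k : ℝ)) : ℂ) * (k : ℂ) ^ (-((zetaOrdinate n : ℂ) * I))‖ + E n) →
      (M : ℝ) * ∑' ρ : Zeros, (riemannZetaZeroOrder (ρ : ℂ) : ℝ) / (ρ : ℂ).im ^ 2 *
          ‖-1 + ∑ m ∈ Finset.Icc 2 M, ((((-1 : ℝ) ^ m * (m : ℝ) ^ (-(1 / 2 : ℝ))) : ℝ) : ℂ) *
            (m : ℂ) ^ ((((ρ : ℂ).im : ℝ) : ℂ) * I)‖ ^ 2 ≤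
        576 * (∑' ρ : Zeros, (riemannZetaZeroOrder (ρ : ℂ) : ℝ) / (ρ : ℂ).im ^ 2) +
        (1 + θ) * (Real.log M / 4 + C₁ + C₂ * (1 + Real.log T₂) ^ 4 / M) +
        2 * (1 + 1 / θ) * ((M : ℝ) * ∑ n ∈ Finset.Ico (zetaZeroCount (4 * ((M / 2 : ℕ) : ℝ))) (zetaZeroCount T₂),
          E n ^ 2 / zetaOrdinate n ^ 2) +
        (M : ℝ) * (432 * A * (1 + Real.log T₂) * (T₂ + M) / T₂ ^ 2 *
          ((3 / 2 + Real.log M ^ 2 / 2) * (1 + Real.log (M + 1)))) := by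
  obtain ⟨C, hC0, hdual⟩ := dual_main_le hRH
  set C₀ : ℝ := (Real.log π + 1) / 16 + 47 * (∑' k : ℕ, 1 / (k : ℝ) ^ (3 / 2 : ℝ)) / π ^ 2 + 23 * π / 8
    with hC₀
  have hZ0 : 0 ≤ ∑' k : ℕ, 1 / (k : ℝ) ^ (3 / 2 : ℝ) := tsum_nonneg fun k ↦ by positivity
  have hlogπ : 0 ≤ Real.log π := Real.log_nonneg (by linarith [Real.pi_gt_three])
  have hC₀0 : 0 ≤ C₀ := by rw [hC₀]; positivity
  refine ⟨4 * C₀, 4 * C, by positivity, by positivity, fun M hM θ hθ hθ1 T₂ hT₂lo hT₂ E hEng ↦ ?_⟩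
  classical
  -- notation
  set a : ℕ → ℝ := fun k ↦ (-1 : ℝ) ^ k * (k : ℝ) ^ (-(1 / 2 : ℝ)) with ha
  set Tlo : ℝ := 4 * ((M / 2 : ℕ) : ℝ) with hTlo
  set f : Zeros → ℝ := fun ρ ↦
    (riemannZetaZeroOrder (ρ : ℂ) : ℝ) / (ρ : ℂ).im ^ 2 * ‖dirPoly a M (ρ : ℂ).im‖ ^ 2 with hf
  set B₀ : ℝ := ∑' ρ : Zeros, (riemannZetaZeroOrder (ρ : ℂ) : ℝ) / (ρ : ℂ).im ^ 2 with hB₀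
  have hM1 : 1 ≤ M := by omega
  have hM3 : 3 ≤ M := by omega
  have hMpos : (0 : ℝ) < M := by exact_mod_cast (show 0 < M by omega)
  have hTlo0 : 0 ≤ Tlo := by rw [hTlo]; positivity
  have hT₂1 : 1 ≤ T₂ := by linarith
  -- the statement's summand is `f`
  have hsummand : ∀ ρ : Zeros, (riemannZetaZeroOrder (ρ : ℂ) : ℝ) / (ρ : ℂ).im ^ 2 *
      ‖-1 + ∑ m ∈ Finset.Icc 2 M, ((((-1 : ℝ) ^ m * (m : ℝ) ^ (-(1 / 2 : ℝ))) : ℝ) : ℂ) *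
        (m : ℂ) ^ ((((ρ : ℂ).im : ℝ) : ℂ) * I)‖ ^ 2 = f ρ := by
    intro ρ; rw [hf, norm_trialVector_eq hM1]
  rw [tsum_congr hsummand]
  -- split: low zeros + middle + tail
  have hsplit : ∑' ρ : Zeros, f ρ = ∑ ρ ∈ zerosUpTo Tlo, f ρ + (∑ ρ ∈ zerosUpTo T₂ \ zerosUpTo Tlo, f ρ +
      ∑' ρ : Zeros, (if ρ ∈ zerosUpTo T₂ then 0 else f ρ)) := by
    rw [tsum_eq_sum_add_tail a M Tlo, tail_eq_sum_add_tail a M hT₂lo]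
  rw [hsplit, mul_add, mul_add]
  -- (1) low zeros
  have hlow : (M : ℝ) * ∑ ρ ∈ zerosUpTo Tlo, f ρ ≤ 576 * B₀ := by
    have h := EtaTrial.smallHeight_le hRH hM3
    rw [Finset.sum_congr rfl fun ρ _ ↦ hsummand ρ] at h
    exact h
  -- (3) the tail
  have htail : (M : ℝ) * ∑' ρ : Zeros, (if ρ ∈ zerosUpTo T₂ then 0 else f ρ) ≤
      (M : ℝ) * (432 * A * (1 + Real.log T₂) * (T₂ + M) / T₂ ^ 2 *
        ((3 / 2 + Real.log M ^ 2 / 2) * (1 + Real.log (M + 1)))) := by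
    refine mul_le_mul_of_nonneg_left ((highBands_le hA0 hA a M hT₂).trans ?_) hMpos.le
    have hlogT : 0 ≤ Real.log T₂ := Real.log_nonneg hT₂1
    have h1 : 0 ≤ 432 * A * (1 + Real.log T₂) * (T₂ + M) / T₂ ^ 2 := by positivity
    refine mul_le_mul_of_nonneg_left (mul_le_mul_of_nonneg_left (sum_etaCoeff_sq_le M) (by positivity)) h1
  -- (2) the middle block
  have hmid : (M : ℝ) * ∑ ρ ∈ zerosUpTo T₂ \ zerosUpTo Tlo, f ρ ≤
      (1 + θ) * (Real.log M / 4 + 4 * C₀ + 4 * C * (1 + Real.log T₂) ^ 4 / M) +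
        2 * (1 + 1 / θ) * ((M : ℝ) * ∑ n ∈ Finset.Ico (zetaZeroCount Tlo) (zetaZeroCount T₂),
          E n ^ 2 / zetaOrdinate n ^ 2) := by
    rw [hf, sum_sdiff_eq_two_mul_sum_Ico a M hTlo0 hT₂lo]
    -- pointwise split
    have hpt : ∀ n ∈ Finset.Ico (zetaZeroCount Tlo) (zetaZeroCount T₂),
        ‖dirPoly a M (zetaOrdinate n)‖ ^ 2 / zetaOrdinate n ^ 2 ≤
          (1 + θ) * (2 * (‖∑ k ∈ (Finset.Icc 1 ⌊zetaOrdinate n / (π * M)⌋₊).filter Odd,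
              (((1 / Real.sqrt k : ℝ)) : ℂ) * (k : ℂ) ^ (-((zetaOrdinate n : ℂ) * I))‖ ^ 2 / zetaOrdinate n ^ 2)) +
          (1 + 1 / θ) * (E n ^ 2 / zetaOrdinate n ^ 2) := by
      intro n hn
      have h := hEng n hn
      rw [altSum_half_eq_dirPoly] at h
      have hD0 := norm_nonneg (dirPoly a M (zetaOrdinate n))
      have hsq : ‖dirPoly a M (zetaOrdinate n)‖ ^ 2 ≤
          (1 + θ) * (Real.sqrt 2 * ‖∑ k ∈ (Finset.Icc 1 ⌊zetaOrdinate n / (π * M)⌋₊).filter Odd,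
              (((1 / Real.sqrt k : ℝ)) : ℂ) * (k : ℂ) ^ (-((zetaOrdinate n : ℂ) * I))‖) ^ 2 +
            (1 + 1 / θ) * E n ^ 2 :=
        (pow_le_pow_left₀ hD0 h 2).trans (add_sq_le_split hθ _ _)
      rw [mul_pow, Real.sq_sqrt (by norm_num)] at hsq
      have hγ : 0 < zetaOrdinate n ^ 2 := pow_pos (zetaOrdinate_pos_holds n) 2
      rw [div_le_iff₀ hγ]
      have hγne : zetaOrdinate n ^ 2 ≠ 0 := hγ.ne'
      have e : ((1 + θ) * (2 * (‖∑ k ∈ (Finset.Icc 1 ⌊zetaOrdinate n / (π * M)⌋₊).filter Odd,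
              (((1 / Real.sqrt k : ℝ)) : ℂ) * (k : ℂ) ^ (-((zetaOrdinate n : ℂ) * I))‖ ^ 2 / zetaOrdinate n ^ 2)) +
          (1 + 1 / θ) * (E n ^ 2 / zetaOrdinate n ^ 2)) * zetaOrdinate n ^ 2 =
          (1 + θ) * (2 * ‖∑ k ∈ (Finset.Icc 1 ⌊zetaOrdinate n / (π * M)⌋₊).filter Odd,
              (((1 / Real.sqrt k : ℝ)) : ℂ) * (k : ℂ) ^ (-((zetaOrdinate n : ℂ) * I))‖ ^ 2) +
            (1 + 1 / θ) * E n ^ 2 := by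
        calc _ = (1 + θ) * (2 * (‖∑ k ∈ (Finset.Icc 1 ⌊zetaOrdinate n / (π * M)⌋₊).filter Odd,
              (((1 / Real.sqrt k : ℝ)) : ℂ) * (k : ℂ) ^ (-((zetaOrdinate n : ℂ) * I))‖ ^ 2 / zetaOrdinate n ^ 2 *
                zetaOrdinate n ^ 2)) +
            (1 + 1 / θ) * (E n ^ 2 / zetaOrdinate n ^ 2 * zetaOrdinate n ^ 2) := by ring
          _ = _ := by rw [div_mul_cancel₀ _ hγne, div_mul_cancel₀ _ hγne]
      rw [e]
      exact hsq
    have hsum := Finset.sum_le_sum hpt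
    rw [Finset.sum_add_distrib, ← Finset.mul_sum, ← Finset.mul_sum, ← Finset.mul_sum] at hsum
    -- the dual main term on the larger range
    have hS0 : ∀ n ∈ Finset.range (zetaZeroCount T₂), 0 ≤
        ‖∑ k ∈ (Finset.Icc 1 ⌊zetaOrdinate n / (π * M)⌋₊).filter Odd,
            (((1 / Real.sqrt k : ℝ)) : ℂ) * (k : ℂ) ^ (-((zetaOrdinate n : ℂ) * I))‖ ^ 2 / zetaOrdinate n ^ 2 :=
      fun n _ ↦ by positivity
    have hsub : Finset.Ico (zetaZeroCount Tlo) (zetaZeroCount T₂) ⊆ Finset.range (zetaZeroCount T₂) := by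
      intro n hn
      rw [Finset.mem_Ico] at hn
      exact Finset.mem_range.2 hn.2
    have hSle := Finset.sum_le_sum_of_subset_of_nonneg hsub fun n hn _ ↦ hS0 n hn
    have hmain := hdual M hM T₂ hT₂1
    have hθ1' : 0 ≤ 1 + θ := by linarith
    have hθ2' : 0 ≤ 1 + 1 / θ := by positivity
    calc (M : ℝ) * (2 * ∑ n ∈ Finset.Ico (zetaZeroCount Tlo) (zetaZeroCount T₂),
          ‖dirPoly a M (zetaOrdinate n)‖ ^ 2 / zetaOrdinate n ^ 2)
        ≤ (M : ℝ) * (2 * ((1 + θ) * (2 * ∑ n ∈ Finset.Ico (zetaZeroCount Tlo) (zetaZeroCount T₂),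
            ‖∑ k ∈ (Finset.Icc 1 ⌊zetaOrdinate n / (π * M)⌋₊).filter Odd,
              (((1 / Real.sqrt k : ℝ)) : ℂ) * (k : ℂ) ^ (-((zetaOrdinate n : ℂ) * I))‖ ^ 2 / zetaOrdinate n ^ 2) +
            (1 + 1 / θ) * ∑ n ∈ Finset.Ico (zetaZeroCount Tlo) (zetaZeroCount T₂), E n ^ 2 / zetaOrdinate n ^ 2)) := by
          gcongr
      _ = 4 * (1 + θ) * ((M : ℝ) * ∑ n ∈ Finset.Ico (zetaZeroCount Tlo) (zetaZeroCount T₂),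
            ‖∑ k ∈ (Finset.Icc 1 ⌊zetaOrdinate n / (π * M)⌋₊).filter Odd,
              (((1 / Real.sqrt k : ℝ)) : ℂ) * (k : ℂ) ^ (-((zetaOrdinate n : ℂ) * I))‖ ^ 2 / zetaOrdinate n ^ 2) +
          2 * (1 + 1 / θ) * ((M : ℝ) * ∑ n ∈ Finset.Ico (zetaZeroCount Tlo) (zetaZeroCount T₂),
            E n ^ 2 / zetaOrdinate n ^ 2) := by ring
      _ ≤ 4 * (1 + θ) * (Real.log M / 16 + C₀ + C * (1 + Real.log T₂) ^ 4 / M) +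
          2 * (1 + 1 / θ) * ((M : ℝ) * ∑ n ∈ Finset.Ico (zetaZeroCount Tlo) (zetaZeroCount T₂),
            E n ^ 2 / zetaOrdinate n ^ 2) := by
          gcongr
          exact (mul_le_mul_of_nonneg_left hSle hMpos.le).trans hmain
      _ = _ := by ring
  linarith

end Summit.RiemannHypothesis.RiemannHypothesis.Theorems.EtaLeadingQuarter.Zeros

end
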